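import Summits.QuantumFields.YangMills.Theorems.ColdStartUniversalityLatticeLangevinMartingaleBernstein
import Summits.QuantumFields.YangMills.Theorems.ColdStartUniversalityLatticeLangevinBlockIncrements
import Summits.QuantumFields.YangMills.Theorems.ColdStartUniversalityLatticeLangevinPoissonEquation
import Summits.QuantumFields.YangMills.Theorems.ColdStartUniversalityLatticeLangevinAsymptoticVarianceNonneg
import Summits.QuantumFields.YangMills.Theorems.ColdStartUniversalityLatticeLangevinRegularFlow
import HarnessLib

/-!
# Route `ColdStartUniversality` (fixed-cut-off SZZ dynamics, sampler package): ★★★ BERNSTEIN'S INEQUALITY WITH THE GREEN–KUBO VARIANCE —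
# `P[∫₀ᵀ Ĝ(U_r)dr ≥ Tε + 2β_u] ≤ exp(−(Tε²/(2σ_b²))·(1 − 2(εB_b/σ_b²)e^(εB_b/σ_b²)))`, `σ_b² = σ²(G) + η_b/b → σ²(G)`

Helper file (seat `ym-line-csu-p1`, g35; `--supports stmt-QuantumFields-24809`).  Hoeffding's inequality for the cold-start sampler (file 70,
`2exp(−cTε²/(576C))`) has the crude Harris constants in the exponent.  The central limit theorem (file 94c) says the right Gaussian scale is the
Green–Kubo variance `σ²(G) = 2∫₀^∞⟨Ĝ,κ_tĜ⟩_μ dt`.  This file proves the matching VARIANCE-SENSITIVE exponential bound (Bernstein regime): there are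
`β_u, K ≥ 0` (`L, β'` only) such that for every realising kernel family, EVERY strong solution from EVERY deterministic start on ANY space, every
continuous `|G| ≤ 1`, every block length `b > 0` and block number `J ≥ 1` (`T = Jb`), with
`B_b = 2β_u + 2b`, `η_b = K + 2β_u((bσ² + K)/√(1+b) + √(1+b)) + 4β_u²`, `v_b = bσ² + η_b` (`v_b/b = σ_b² → σ²` as `b → ∞`):
* ★★ `timeIntegral_tail_le_exp_of_blocks` — for every `λ ≥ 0` and real `r`,
  `P[∫_(0,T] Ĝ(U_r)dr ≥ r + 2β_u] ≤ exp(−λr + Jλ²v_b(1/2 + λB_b e^(λB_b)))` (and the same for the lower tail);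
* ★★★ `timeIntegral_tail_le_bernstein` — for `r ≥ 0`, BOTH tails:
  `P[±∫_(0,T] Ĝ(U_r)dr ≥ r + 2β_u] ≤ exp(−(r²/(2Jv_b))·(1 − 2(rB_b/(Jv_b))e^(rB_b/(Jv_b))))`;
  with `r = Tε`: rate `Tε²/(2σ_b²)·(1 − O(εb/σ_b²))` — for small `ε` and long blocks the exponent is the SHARP Gaussian one `Tε²/(2σ²(G))`
  (Lezaud-type Chernoff bound for an ergodic Markov process, from a non-stationary start).
Proof: block increments of the Poisson martingale (file 94a: orthogonal to the past, `E[Z D_k²] ≤ v_b E[Z]`), the generic Bennett–Bernstein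
mechanism (file 96a), boundary term `|u(U_T) − u(x)| ≤ 2β_u`, regular flow + pathwise uniqueness.  THEOREMS ONLY, no definition, no sorry;
[folklore] (Bernstein; Lezaud 1998 Ann. Appl. Probab. 8; Paulin 2015).  HONEST FRAMING: fixed cut-off; `β_u, K, σ²` depend on `L, β'`;
`UniformColdStartMixing` (24809) is NOT restated; no crux, rung or summit statement is proved; the Yang–Mills mass gap is NOT proved.
-/

set_option autoImplicit false

noncomputable section

namespace Summit.QuantumFields.YangMills.Theorems.ColdStartUniversality

open MeasureTheory ProbabilityTheory Filter Topology Set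
open scoped NNReal ENNReal BigOperators
open Literature Literature.Probability.Process Literature.MathematicalPhysics.QuantumFieldTheory
open Literature.MathematicalPhysics.QuantumLattice (fundamentalRep fundamentalLatticeRep continuous_fundamentalRep)

variable {L : ℕ} [NeZero L]

/-- ★★★ **Bernstein's inequality with the Green–Kubo variance for time integrals of the cold-start SZZ sampler** (Chernoff form for every
`λ ≥ 0`, and the optimised two-sided Bernstein form).  See the module docstring. [folklore] -/
theorem timeIntegral_tail_le_bernstein (L : ℕ) [NeZero L] (β' : ℝ) :
    ∃ βu K : ℝ, 0 ≤ βu ∧ 0 < K ∧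
      ∀ (κ : ℝ≥0 → Kernel (GaugeConfig 3 L (Matrix.specialUnitaryGroup (Fin 2) ℂ))
          (GaugeConfig 3 L (Matrix.specialUnitaryGroup (Fin 2) ℂ))) [∀ t, IsMarkovKernel (κ t)],
        (∀ (t : ℝ≥0) (x : GaugeConfig 3 L (Matrix.specialUnitaryGroup (Fin 2) ℂ))
          (Ω : Type) [MeasurableSpace Ω] (P : Measure Ω) [IsProbabilityMeasure P]
          (W : ℝ≥0 → Ω → (Edge 3 L × NoiseIdx 2 → ℝ)) (hW : IsFlatBrownian W P)
          (U : ℝ≥0 → Ω → GaugeConfig 3 L (Matrix.specialUnitaryGroup (Fin 2) ℂ)),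
          (∀ ω, U 0 ω = x) →
          (latticeLangevinDynamics (fundamentalLatticeRep 2) β').IsSolution (fundamentalRep (Fin 2))
            hW.natFiltration P W U →
          κ t x = P.map (U t)) →
        ∀ (x : GaugeConfig 3 L (Matrix.specialUnitaryGroup (Fin 2) ℂ))
          (Ω : Type) [MeasurableSpace Ω] (P : Measure Ω) [IsProbabilityMeasure P]
          (W : ℝ≥0 → Ω → (Edge 3 L × NoiseIdx 2 → ℝ)) (hW : IsFlatBrownian W P)
          (U : ℝ≥0 → Ω → GaugeConfig 3 L (Matrix.specialUnitaryGroup (Fin 2) ℂ)),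
          (∀ ω, U 0 ω = x) →
          (latticeLangevinDynamics (fundamentalLatticeRep 2) β').IsSolution (fundamentalRep (Fin 2)) hW.natFiltration P W U →
        ∀ (G : GaugeConfig 3 L (Matrix.specialUnitaryGroup (Fin 2) ℂ) → ℝ), Continuous G → (∀ z, |G z| ≤ 1) →
        ∀ (σ2 : ℝ), σ2 = 2 * ∫ t in Ioi (0 : ℝ),
            (∫ y, (G y - ∫ z, G z ∂(wilsonMeasure (d := 3) (L := L) (fundamentalRep (Fin 2)) β')) *
              (∫ z, (G z - ∫ z', G z' ∂(wilsonMeasure (d := 3) (L := L) (fundamentalRep (Fin 2)) β')) ∂(κ t.toNNReal y))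
              ∂(wilsonMeasure (d := 3) (L := L) (fundamentalRep (Fin 2)) β')) →
        ∀ (b : ℝ), 0 < b → ∀ (J : ℕ), 1 ≤ J →
        ∀ (ηb vb Bb : ℝ), ηb = K + 2 * βu * ((b * σ2 + K) / Real.sqrt (1 + b) + Real.sqrt (1 + b)) + 4 * βu ^ 2 →
          vb = b * σ2 + ηb → Bb = 2 * βu + 2 * b →
          0 ≤ σ2 ∧ 0 < vb ∧
          (∀ (l : ℝ), 0 ≤ l → ∀ (r : ℝ),
            P.real {ω | r + 2 * βu ≤ ∫ s in Ioc (0 : ℝ) (J * b),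
                (G (U s.toNNReal ω) - ∫ z, G z ∂(wilsonMeasure (d := 3) (L := L) (fundamentalRep (Fin 2)) β'))} ≤
              Real.exp (-l * r + J * (l ^ 2 * vb * (1 / 2 + l * Bb * Real.exp (l * Bb)))) ∧
            P.real {ω | r + 2 * βu ≤ -∫ s in Ioc (0 : ℝ) (J * b),
                (G (U s.toNNReal ω) - ∫ z, G z ∂(wilsonMeasure (d := 3) (L := L) (fundamentalRep (Fin 2)) β'))} ≤
              Real.exp (-l * r + J * (l ^ 2 * vb * (1 / 2 + l * Bb * Real.exp (l * Bb))))) ∧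
          (∀ (r : ℝ), 0 ≤ r →
            P.real {ω | r + 2 * βu ≤ ∫ s in Ioc (0 : ℝ) (J * b),
                (G (U s.toNNReal ω) - ∫ z, G z ∂(wilsonMeasure (d := 3) (L := L) (fundamentalRep (Fin 2)) β'))} ≤
              Real.exp (-(r ^ 2 / (2 * (J * vb))) * (1 - 2 * (r * Bb / (J * vb)) * Real.exp (r * Bb / (J * vb)))) ∧
            P.real {ω | r + 2 * βu ≤ -∫ s in Ioc (0 : ℝ) (J * b),
                (G (U s.toNNReal ω) - ∫ z, G z ∂(wilsonMeasure (d := 3) (L := L) (fundamentalRep (Fin 2)) β'))} ≤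
              Real.exp (-(r ^ 2 / (2 * (J * vb))) * (1 - 2 * (r * Bb / (J * vb)) * Real.exp (r * Bb / (J * vb))))) := by
  classical
  haveI := secondCountableTopology_su2
  haveI := borelSpace_config L
  obtain ⟨Cu, cu, hCu, hcu, hPoisAll⟩ := exists_poisson_solution L β'
  obtain ⟨K₀, hK₀, hblocks⟩ := exists_blockIncrements L β'
  refine ⟨2 * Cu / cu, K₀ + 1, by positivity, by linarith,
    fun κ _ hreal x Ω _ P _ W hW U hU0 hU G hGc hG1 σ2 hσ2 b hb J hJ ηb vb Bb hηb hvb hBb => ?_⟩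
  set μ : Measure (GaugeConfig 3 L (Matrix.specialUnitaryGroup (Fin 2) ℂ)) :=
    wilsonMeasure (d := 3) (L := L) (fundamentalRep (Fin 2)) β' with hμ
  haveI : IsProbabilityMeasure μ :=
    isProbabilityMeasure_wilsonMeasure (d := 3) (L := L) (fundamentalRep (Fin 2)) (continuous_fundamentalRep (Fin 2)) β'
  set m : ℝ := ∫ z, G z ∂μ with hm
  have hG : Measurable G := hGc.measurable
  set Gh : GaugeConfig 3 L (Matrix.specialUnitaryGroup (Fin 2) ℂ) → ℝ := fun z => G z - m with hGh
  have hGhc : Continuous Gh := hGc.sub continuous_const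
  have hGhm : Measurable Gh := hG.sub measurable_const
  have hGhb : ∀ z, |Gh z| ≤ 2 := fun z => by
    have hm1 : |m| ≤ 1 := by
      have hh := norm_integral_le_of_norm_le_const (μ := μ) (f := G) (C := 1)
        (Eventually.of_forall fun z => by simpa [Real.norm_eq_abs] using hG1 z)
      simpa [Real.norm_eq_abs] using hh
    show |G z - m| ≤ 2
    have := abs_sub (G z) m
    linarith [hG1 z]
  have hGh0 : ∫ z, Gh z ∂μ = 0 := by
    simp only [hGh]
    rw [integral_sub ((integrable_const (1 : ℝ)).mono' hG.aestronglyMeasurable (Eventually.of_forall fun z => by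
      simpa [Real.norm_eq_abs] using hG1 z)) (integrable_const m), integral_const, smul_eq_mul, probReal_univ, one_mul, hm]
    exact sub_self _
  have hσ0 : 0 ≤ σ2 := by rw [hσ2]; exact mul_nonneg (by norm_num) (greenKubo_nonneg L β' κ hreal hGc hG1)
  set βu : ℝ := 2 * Cu / cu with hβu
  have hβ0 : 0 ≤ βu := by positivity
  have hηb0 : K₀ + 1 ≤ ηb := by
    rw [hηb]
    have : 0 ≤ 2 * βu * ((b * σ2 + (K₀ + 1)) / Real.sqrt (1 + b) + Real.sqrt (1 + b)) + 4 * βu ^ 2 := by positivity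
    linarith
  have hvb0 : 0 < vb := by rw [hvb]; nlinarith [hK₀, hηb0, hb, hσ0]
  have hBb0 : 0 ≤ Bb := by rw [hBb]; positivity
  /- ### 1. Regular flow, corrector, block increments -/
  obtain ⟨V, -, hV, hVprog, -, -, -⟩ := exists_regularFlow L β' hW
  have hprog : ∀ i : ℝ≥0, Measurable[@Prod.instMeasurableSpace (Set.Iic i) Ω inferInstance (hW.natFiltration i)]
      (fun q : Set.Iic i × Ω => V x q.1 q.2) := fun i =>
    (hVprog i).comp (measurable_fst.prodMk (measurable_const.prodMk measurable_snd))
  have hae : ∀ᵐ ω ∂P, ∀ t, U t ω = V x t ω := latticeLangevin_pathwise_unique hW β' x hU0 (hV x).1 hU (hV x).2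
  obtain ⟨u, huc, -, hub', -, hPois⟩ := hPoisAll κ hreal Gh hGhc hGh0 2 hGhb
  have hum : Measurable u := huc.measurable
  have hub : ∀ y, |u y| ≤ βu := fun y => (hub' y).trans (le_of_eq hβu.symm)
  obtain ⟨D, hDF, hDb, horth, hvar, htel⟩ := hblocks κ hreal x Ω P W hW (V x) (hV x).1 (hV x).2 hprog G hGc hG1 u hum βu hub hPois b hb
  -- conditional variance `≤ v_b` (file 94a with `K₀ ≤ K₀ + 1`)
  have hvar' : ∀ k < J, ∀ (Z : Ω → ℝ), Measurable[hW.natFiltration (((k : ℝ) * b).toNNReal)] Z → (∀ ω, 0 ≤ Z ω) →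
      (∃ CZ : ℝ, ∀ ω, Z ω ≤ CZ) → ∫ ω, Z ω * D k ω ^ 2 ∂P ≤ vb * ∫ ω, Z ω ∂P := by
    intro k _ Z hZ hZ0 hZb
    have h := hvar k Z hZ hZ0 hZb
    rw [← hσ2, abs_of_nonneg hσ0] at h
    have hEZ0 : 0 ≤ ∫ ω, Z ω ∂P := integral_nonneg hZ0
    have hZm : Measurable Z := hZ.mono (hW.natFiltration.le _) le_rfl
    obtain ⟨CZ, hCZ⟩ := hZb
    have hC0 : 0 ≤ CZ := (hZ0 (Classical.choice (nonempty_of_isProbabilityMeasure P))).trans (hCZ _)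
    have iZ : Integrable Z P := (integrable_const CZ).mono' hZm.aestronglyMeasurable
      (Eventually.of_forall fun ω => by rw [Real.norm_eq_abs, abs_of_nonneg (hZ0 ω)]; exact hCZ ω)
    have iZD2 : Integrable (fun ω => Z ω * D k ω ^ 2) P := (integrable_const (CZ * (2 * βu + 2 * b) ^ 2)).mono'
      (hZm.mul (((hDF k).mono (hW.natFiltration.le _) le_rfl).pow_const 2)).aestronglyMeasurable
      (Eventually.of_forall fun ω => by
        rw [Real.norm_eq_abs, abs_mul, abs_of_nonneg (hZ0 ω), abs_of_nonneg (sq_nonneg _)]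
        refine mul_le_mul (hCZ ω) ?_ (sq_nonneg _) hC0
        rw [← sq_abs]; exact pow_le_pow_left₀ (abs_nonneg _) (hDb k ω) 2)
    have hsplit : ∫ ω, Z ω * (D k ω ^ 2 - b * σ2) ∂P = (∫ ω, Z ω * D k ω ^ 2 ∂P) - b * σ2 * ∫ ω, Z ω ∂P := by
      rw [← integral_const_mul, ← integral_sub iZD2 (iZ.const_mul _)]
      exact integral_congr_ae (ae_of_all _ fun ω => by ring)
    rw [hsplit] at h
    have h1 := (abs_le.1 h).2
    -- `η_b(K₀) ≤ η_b(K₀+1) = ηb`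
    have hηle : K₀ + 2 * βu * ((b * σ2 + K₀) / Real.sqrt (1 + b) + Real.sqrt (1 + b)) + 4 * βu ^ 2 ≤ ηb := by
      rw [hηb]
      have hs : 0 < Real.sqrt (1 + b) := Real.sqrt_pos.2 (by linarith)
      have : (b * σ2 + K₀) / Real.sqrt (1 + b) ≤ (b * σ2 + (K₀ + 1)) / Real.sqrt (1 + b) := div_le_div_of_nonneg_right (by linarith) hs.le
      nlinarith [hβ0]
    rw [hvb]
    nlinarith [h1, hηle, hEZ0]
  /- ### 2. The generic Bernstein mechanism for `D` and for `−D` -/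
  have hmono : ∀ j k : ℕ, j ≤ k → (((j : ℝ) * b).toNNReal) ≤ (((k : ℝ) * b).toNNReal) := fun j k hjk =>
    Real.toNNReal_le_toNNReal (mul_le_mul_of_nonneg_right (by exact_mod_cast hjk) hb.le)
  have hDm : ∀ k, Measurable (D k) := fun k => (hDF k).mono (hW.natFiltration.le _) le_rfl
  have hSF : ∀ k : ℕ, Measurable[hW.natFiltration (((k : ℝ) * b).toNNReal)] fun ω => ∑ j ∈ Finset.range k, D j ω := fun k =>
    Finset.measurable_sum _ fun j hj =>
      (hDF j).mono (hW.natFiltration.mono (hmono (j + 1) k (Nat.succ_le_of_lt (Finset.mem_range.1 hj)))) le_rfl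
  have hSFn : ∀ k : ℕ, Measurable[hW.natFiltration (((k : ℝ) * b).toNNReal)] fun ω => ∑ j ∈ Finset.range k, -D j ω := fun k =>
    Finset.measurable_sum _ fun j hj =>
      ((hDF j).mono (hW.natFiltration.mono (hmono (j + 1) k (Nat.succ_le_of_lt (Finset.mem_range.1 hj)))) le_rfl).neg
  have horthJ : ∀ k < J, ∀ (Z : Ω → ℝ), Measurable[hW.natFiltration (((k : ℝ) * b).toNNReal)] Z → (∀ ω, 0 ≤ Z ω) →
      (∃ CZ : ℝ, ∀ ω, Z ω ≤ CZ) → ∫ ω, Z ω * D k ω ∂P = 0 := fun k _ Z hZ hZ0 hZb => horth k Z hZ hZ0 hZb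
  have horthn : ∀ k < J, ∀ (Z : Ω → ℝ), Measurable[hW.natFiltration (((k : ℝ) * b).toNNReal)] Z → (∀ ω, 0 ≤ Z ω) →
      (∃ CZ : ℝ, ∀ ω, Z ω ≤ CZ) → ∫ ω, Z ω * -D k ω ∂P = 0 := fun k hk Z hZ hZ0 hZb => by
    have h := horth k Z hZ hZ0 hZb
    rw [integral_congr_ae (ae_of_all _ fun ω => show Z ω * -D k ω = -(Z ω * D k ω) by ring), integral_neg, h, neg_zero]
  have hvarn : ∀ k < J, ∀ (Z : Ω → ℝ), Measurable[hW.natFiltration (((k : ℝ) * b).toNNReal)] Z → (∀ ω, 0 ≤ Z ω) →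
      (∃ CZ : ℝ, ∀ ω, Z ω ≤ CZ) → ∫ ω, Z ω * (-D k ω) ^ 2 ∂P ≤ vb * ∫ ω, Z ω ∂P := fun k hk Z hZ hZ0 hZb => by
    simp only [neg_sq]; exact hvar' k hk Z hZ hZ0 hZb
  have hDbn : ∀ k ω, |(-D k ω)| ≤ Bb := fun k ω => by rw [abs_neg, hBb]; exact hDb k ω
  have hDb' : ∀ k ω, |D k ω| ≤ Bb := fun k ω => by rw [hBb]; exact hDb k ω
  /- ### 3. The events along `U` and along `V` -/
  set T : ℝ := J * b with hT
  set IU : Ω → ℝ := fun ω => ∫ s in Ioc (0 : ℝ) (J * b), Gh (U s.toNNReal ω) with hIU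
  set IV : Ω → ℝ := fun ω => ∫ s in Ioc (0 : ℝ) (J * b), Gh (V x s.toNNReal ω) with hIV
  have hIUV : IU =ᵐ[P] IV := by
    filter_upwards [hae] with ω hω
    simp only [hIU, hIV]
    have : (fun s : ℝ => Gh (U s.toNNReal ω)) = fun s : ℝ => Gh (V x s.toNNReal ω) := funext fun s => by rw [hω]
    rw [this]
  have hIVS : ∀ ω, IV ω = (∑ k ∈ Finset.range J, D k ω) - (u (V x (((J : ℝ) * b).toNNReal) ω) - u x) := fun ω => by
    rw [htel J ω]; simp only [hIV]; ring
  have hsubU : ∀ r : ℝ, {ω | r + 2 * βu ≤ IU ω} =ᵐ[P] ({ω | r + 2 * βu ≤ IV ω} : Set Ω) := fun r => by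
    filter_upwards [hIUV] with ω hω
    change (r + 2 * βu ≤ IU ω) = (r + 2 * βu ≤ IV ω)
    rw [show IU ω = IV ω from hω]
  have hsubUn : ∀ r : ℝ, {ω | r + 2 * βu ≤ -IU ω} =ᵐ[P] ({ω | r + 2 * βu ≤ -IV ω} : Set Ω) := fun r => by
    filter_upwards [hIUV] with ω hω
    change (r + 2 * βu ≤ -IU ω) = (r + 2 * βu ≤ -IV ω)
    rw [show IU ω = IV ω from hω]
  have hinclV : ∀ r : ℝ, {ω | r + 2 * βu ≤ IV ω} ⊆ {ω | r ≤ ∑ k ∈ Finset.range J, D k ω} := fun r ω hω => by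
    simp only [Set.mem_setOf_eq] at hω ⊢
    rw [hIVS] at hω
    have h1 : |u (V x (((J : ℝ) * b).toNNReal) ω) - u x| ≤ 2 * βu :=
      (abs_sub _ _).trans (by linarith [hub (V x (((J : ℝ) * b).toNNReal) ω), hub x])
    linarith [(abs_le.1 h1).1, (abs_le.1 h1).2]
  have hinclVn : ∀ r : ℝ, {ω | r + 2 * βu ≤ -IV ω} ⊆ {ω | r ≤ ∑ k ∈ Finset.range J, -D k ω} := fun r ω hω => by
    simp only [Set.mem_setOf_eq] at hω ⊢
    rw [hIVS] at hω
    have h1 : |u (V x (((J : ℝ) * b).toNNReal) ω) - u x| ≤ 2 * βu :=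
      (abs_sub _ _).trans (by linarith [hub (V x (((J : ℝ) * b).toNNReal) ω), hub x])
    rw [Finset.sum_neg_distrib]
    linarith [(abs_le.1 h1).1, (abs_le.1 h1).2]
  /- ### 4. Assemble -/
  refine ⟨hσ0, hvb0, fun l hl r => ⟨?_, ?_⟩, fun r hr => ⟨?_, ?_⟩⟩
  · rw [measureReal_congr (hsubU r)]
    exact (measureReal_mono (hinclV r)).trans
      (measureReal_sum_ge_le_of_condVariance (fun k : ℕ => hW.natFiltration (((k : ℝ) * b).toNNReal)) (fun k => hW.natFiltration.le _)
        D hDm hBb0 hDb' hSF J horthJ hvar' hl r)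
  · rw [measureReal_congr (hsubUn r)]
    exact (measureReal_mono (hinclVn r)).trans
      (measureReal_sum_ge_le_of_condVariance (fun k : ℕ => hW.natFiltration (((k : ℝ) * b).toNNReal)) (fun k => hW.natFiltration.le _)
        (fun k ω => -D k ω) (fun k => (hDm k).neg) hBb0 hDbn hSFn J horthn hvarn hl r)
  · rw [measureReal_congr (hsubU r)]
    exact (measureReal_mono (hinclV r)).trans
      (measureReal_sum_ge_le_bernstein (fun k : ℕ => hW.natFiltration (((k : ℝ) * b).toNNReal)) (fun k => hW.natFiltration.le _)
        D hDm hBb0 hvb0 hDb' hSF hJ horthJ hvar' hr)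
  · rw [measureReal_congr (hsubUn r)]
    exact (measureReal_mono (hinclVn r)).trans
      (measureReal_sum_ge_le_bernstein (fun k : ℕ => hW.natFiltration (((k : ℝ) * b).toNNReal)) (fun k => hW.natFiltration.le _)
        (fun k ω => -D k ω) (fun k => (hDm k).neg) hBb0 hvb0 hDbn hSFn hJ horthn hvarn hr)

end Summit.QuantumFields.YangMills.Theorems.ColdStartUniversality

end
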